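import Summits.BirchSwinnertonDyer.BirchSwinnertonDyer.Theorems.CountingDoorF2AtThreeRootNumberBias
import HarnessLib

/-!
# BirchSwinnertonDyer / CountingDoorF2AtThree — crux I2 `RootNumberPlusLowerDensityLargeF2`
# (stmt-BirchSwinnertonDyer-19441), lane «closed-form local root numbers»: the typed door in CLASSICAL
# currency — a `2/3`-bias bound for `μ(m)·J(−c₆(a) | m)` (`m` the odd part of `|Δ(a)|`) closes the leaf with I1

Companion of `Theorems/CountingDoorF2AtThreeRootNumberBias.lean` (§5 there: PublishedInputsAtThree → I1 →
Modularity → I2sf → leaf, with I2sf a bias bound for the explicit signed product `σ(a) = ∏_{p ∣ Δ(a)} s_p(a)`)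
and of `…RootNumberClosedForm.lean` §4 (uniform normal form `w(E_a) = −μ(m)·J(−c₆(a) | m)` on the
squarefree locus). Here the door's hypothesis is rewritten in the currency an analytic number theorist
would use:

* `liouvilleJacobiSign_eq_moebius_mul_jacobiSym` — on the squarefree locus `σ(a) = μ(m)·J(−c₆(a) | m)`,
  `m = |Δ(a)|` (odd `Δ`) or `|Δ(a)|/2` (even `Δ`) — the Möbius function of the odd part of the
  discriminant times Rohrlich's Jacobi symbol (stated modulo Modularity, through the two normal forms);
* `pAdicBSDRankTwoPositiveProportion_of_selmerAverage_of_moebiusJacobiBias` — **the leaf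
  `PAdicBSDRankTwoPositiveProportion` from the published inputs at `3`, crux I1, the Modularity Theorem and
  ONE analytic statement**: on every large congruence subfamily of `F₂` with nonempty local conditions whose
  members have squarefree discriminant, `limsup_X (1/#Φ(<X)) ∑_{a ∈ Φ(<X)} μ(m_a)·J(−c₆(a) | m_a) < 2/3`.

HONEST STATUS: that analytic statement (a `2/3`-BIAS weak-Chowla bound for the Möbius function of the
irreducible weighted-degree-12 discriminant form of `F₂`, twisted by a Jacobi symbol, over congruence-sieve
families ordered by Bhargava–Ho height) is OPEN — nothing in print proves a bias bound for `μ ∘ P`,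
`P` irreducible of degree `≥ 4` (Helfgott: factors of degree `≤ 3`). Nothing here proves I2; no S0 motion.
PARTITION: none — r_an ≥ 2, summit axis S0; TWIN (D-0056): n/a. B1 honesty: bookkeeping; nothing reads r_an.

References: D. Rohrlich, *Compositio Math.* 87 (1993) Prop. 2 [Rohrlich1993Compositio]; H. A. Helfgott,
arXiv:math/0408141 §1 [Helfgott2004RootNumber]; M. Bhargava, A. Shankar, *Ann. of Math.* 181 (2015) §1
[BhargavaShankarTernary2015]; M. Bhargava, W. Ho, arXiv:2207.03309 [BhargavaHo2022].
-/

set_option linter.dupNamespace false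
set_option autoImplicit false

noncomputable section

open scoped Classical NumberTheorySymbols

open Filter Topology Finset WeierstrassCurve
  Literature.NumberTheory.EllipticCurves.BhargavaHo2022
  Summit.BirchSwinnertonDyer.BirchSwinnertonDyer.Theses.CountingDoorF2AtThree
  Summit.BirchSwinnertonDyer.BirchSwinnertonDyer.Theorems.SemistableRootNumber
  Summit.BirchSwinnertonDyer.BirchSwinnertonDyer.Theorems.F2RootNumber

namespace Summit.BirchSwinnertonDyer.BirchSwinnertonDyer.Theorems.F2RootNumber

/-! ### The door hypothesis in classical currency: the average of `μ(m)·J(−c₆(a) | m)` -/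

/-- On the squarefree locus the explicit sign of the typed door equals `μ(m)·J(−c₆(a) | m)`, `m` the odd
part of `|Δ(a)|` (both equal `−w(E_a)`; stated modulo Modularity, through the two normal forms).
[cite: Rohrlich1993Compositio, Prop. 2(ii)] [cite: Helfgott2004RootNumber, §1] -/
theorem liouvilleJacobiSign_eq_moebius_mul_jacobiSym (a : Params) (hsq : Squarefree a.curveInt.Δ)
    (hmod : Literature.NumberTheory.EllipticCurves.ModularForms.exists_isNewformOf) :
    ((∏ p ∈ a.curveInt.Δ.natAbs.primeFactors,
        (if p = 2 then (if (2 : ℤ) ∣ a.a₁ * a.a₃ then -1 else 1)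
         else -J(-(a.curveInt.c₄ * a.curveInt.c₆) | p)) : ℤ) : ℝ) =
      ((ArithmeticFunction.moebius (if (2 : ℤ) ∣ a.curveInt.Δ then a.curveInt.Δ.natAbs / 2
          else a.curveInt.Δ.natAbs) *
        J(-a.curveInt.c₆ | (if (2 : ℤ) ∣ a.curveInt.Δ then a.curveInt.Δ.natAbs / 2
          else a.curveInt.Δ.natAbs)) : ℤ) : ℝ) := by
  have hw := rootNumber_curve_eq_neg_prod_primeFactors a hsq.ne_zero
    (forall_not_dvd_c₄_of_squarefree hsq) hmod
  have key : (∏ p ∈ a.curveInt.Δ.natAbs.primeFactors,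
        (if p = 2 then (if (2 : ℤ) ∣ a.a₁ * a.a₃ then -1 else 1)
         else -J(-(a.curveInt.c₄ * a.curveInt.c₆) | p)) : ℤ) =
      ArithmeticFunction.moebius (if (2 : ℤ) ∣ a.curveInt.Δ then a.curveInt.Δ.natAbs / 2
          else a.curveInt.Δ.natAbs) *
        J(-a.curveInt.c₆ | (if (2 : ℤ) ∣ a.curveInt.Δ then a.curveInt.Δ.natAbs / 2
          else a.curveInt.Δ.natAbs)) := by
    by_cases h2 : (2 : ℤ) ∣ a.curveInt.Δ
    · have h := rootNumber_curve_eq_neg_moebius_mul_jacobiSym_of_even a hsq h2 hmod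
      rw [if_pos h2]
      linarith [hw, h]
    · have h := rootNumber_curve_eq_neg_moebius_mul_jacobiSym_of_odd a hsq h2 hmod
      rw [if_neg h2]
      linarith [hw, h]
  exact_mod_cast key

/-- **The leaf from the published inputs at `3`, I1, Modularity and a `2/3`-bias bound for
`μ(m)·J(−c₆(a) | m)`** — the typed door of §5 with its hypothesis in classical currency: on every large
`Φ ⊆ F₂` with nonempty local conditions whose members have squarefree `Δ`, some `θ < 2/3` bounds the
`limsup` of the average of `μ(m_a)·J(−c₆(a) | m_a)`, `m_a` = the odd part of `|Δ(a)|` (the Möbius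
function of the discriminant times Rohrlich's Jacobi symbol). [cite: BhargavaShankarTernary2015, §1]
[cite: Helfgott2004RootNumber, §1] [cite: Rohrlich1993Compositio, Prop. 2(ii)] -/
theorem pAdicBSDRankTwoPositiveProportion_of_selmerAverage_of_moebiusJacobiBias
    (hIn : PublishedInputsAtThree) (h1 : SelmerThreeAverageLargeF2)
    (hmod : Literature.NumberTheory.EllipticCurves.ModularForms.exists_isNewformOf)
    (hbias : ∀ Φ : CongruenceFamily₂, Φ.IsLarge → (∀ p : ℕ, p.Prime → (Φ.residues p).Nonempty) →
      (∀ a : Params, Φ.Mem a → Squarefree a.curveInt.Δ) →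
      ∃ θ : ℝ, θ < 2 / 3 ∧
        Φ.AverageOnLE (fun a ↦ ((ArithmeticFunction.moebius
            (if (2 : ℤ) ∣ a.curveInt.Δ then a.curveInt.Δ.natAbs / 2 else a.curveInt.Δ.natAbs) *
          J(-a.curveInt.c₆ | (if (2 : ℤ) ∣ a.curveInt.Δ then a.curveInt.Δ.natAbs / 2
            else a.curveInt.Δ.natAbs)) : ℤ) : ℝ)) θ) :
    PAdicBSDRankTwoPositiveProportion := by
  refine pAdicBSDRankTwoPositiveProportion_of_selmerAverage_of_liouvilleJacobiBias hIn h1 hmod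
    fun Φ hL hne hsf ↦ ?_
  obtain ⟨θ, hθ, hA⟩ := hbias Φ hL hne hsf
  refine ⟨θ, hθ, fun ε hε ↦ ?_⟩
  filter_upwards [hA ε hε] with X hX
  refine le_of_eq_of_le ?_ hX
  unfold CongruenceFamily₂.averageOn
  congr 1
  refine Finset.sum_congr rfl fun a ha ↦ ?_
  exact liouvilleJacobiSign_eq_moebius_mul_jacobiSym a (hsf a ((Φ.mem_below_iff a X).mp ha).1) hmod

end Summit.BirchSwinnertonDyer.BirchSwinnertonDyer.Theorems.F2RootNumber

end
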